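import Literature.Barriers.ValiantsHypothesis.FullRankMultilinearHolds
import Literature.Barriers.ValiantsHypothesis.FullRankMultilinearFormulaLowerBound
import Literature.Barriers.ValiantsHypothesis.FullRankMultilinearFormulaBridge
import Literature.Computability.AlgebraicComplexity.AndrewsForbes2022Applications
import Literature.Computability.AlgebraicComplexity.AndrewsForbes2022BorderLST
import HarnessLib

/-!
# Route `VPBoundarySquare` — BORDER RAZ: no full-rank polynomial is even approximated by small
# syntactically multilinear formulas; multilinear NC¹ ≠ NC² holds IN THE BORDER (every field)

Decomp-valiant workshop, lens 3 «border-complexity / debordering axis», generation 32; offer O8 (called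
by the workshop critic; serves census cell W29's ladder field «`per ∉ cl(multilinear formulas)` — the rank
method de-borders — not in the tree as a border statement» at the level the tree's exact-world input
reaches: FULL-RANK polynomials).  Unconditional, 0 sorry, no named fact, no new currency (the tree's
`borderClass`, `PolyOrdGE`, `pdMatrix`, `IsFullRank`, `WExpr`, `IsSyntMultilinear` only; the formula class
is written inline as a set).  CALIBRATION of the lens-3 record: it does NOT prove `VP ≠ VNP`, moves no tag,
closes no crux, names no new open cell.

WHAT IS PROVED (all kernel).  `F((ε)) = LaurentSeries F`; `h ∈ F((ε))[x]` APPROXIMATES `g ∈ F[x]` when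
`h - g = O(ε)` coefficientwise (`PolyOrdGE 1`, Andrews–Forbes 2022 Def. 2.1 = the tree's `borderClass`);
`M(g^A) = pdMatrix (rename A g)` is Raz's `2^m × 2^m` partial-derivative matrix under the balanced
partition `A`, and `g` is of FULL RANK when `rank M(g^A) = 2^m` for every `A` (`IsFullRank`).

* `pdMatrix_rank_le_of_polyOrdGE` — THE MECHANISM («rank methods are blind to `O(ε)`», third model
  after generation 31's constant-depth LST window and Bhargav–Dutta–Saxena law): if `h` approximates
  `g` then `rank_F M(g) ≤ rank_{F((ε))} M(h)` — Andrews–Forbes 2022 Lemma 6.2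
  (`BorderLST.finrank_span_le_of_isOrdGE`) carried from the LST coefficient matrix to Raz's matrix.
* `not_isFullRank_of_syntMultilinear_uniform` — the tree's Raz 2006 Cor. 3.6
  (`RazFormula.not_isFullRank_of_syntMultilinear_core`, CALLED, not re-proved) with the threshold
  `n₀(b)` chosen BEFORE the field (the tree's wrapper fixes the field first; its `n₀` is field-free
  but hidden under `∃`, and the border statements below live over the `n`-dependent fields
  `F(W_n)((ε))`); only the numeric side conditions of `_core` are discharged here (`ℓ = 2(b+2)`,
  `m = ⌊u/4^ℓ⌋`, `D = b(⌊log₂ u⌋+1)+2`; polylog-versus-linear asymptotics `exists_const_mul_pow_log_le`).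
* ★ `not_isFullRank_of_mem_borderClass_smlFormula` (field-uniform form `…_uniform`; circuit-model
  form `not_isFullRank_of_border_syntMultilinear_formula`) — **BORDER RAZ: for every `b` there is `n₀`
  such that for all `u ≥ n₀`, over every field `F`, no full-rank `g ∈ F[x_1,…,x_{2u}]` lies in
  `borderClass F {Φ.eval | Φ a syntactically multilinear formula over F((ε)), |Φ| ≤ u^b}`**: the
  tree's theorem run over the FIELD `F((ε))` gives some `rank M(Φ.eval^A) < 2^u`, and the mechanism
  gives `rank_F M(g^A) ≤ rank_{F((ε))} M(Φ.eval^A)` (renaming keeps `O(ε)`: `polyOrdGE_rename_equiv`).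
  BORDER = EXACT for the full-rank method: same `n₀(b)`, same proof.
* ★ `razYehudayoffPolyK_not_mem_borderClass_smlFormula`, `smCircuits_not_subset_border_smlFormulas` —
  with the tree's `RazYehudayoff2008_thm42_holds` (the Raz–Yehudayoff polynomial `f_n` over
  `G_n = F(W_n)` is of full rank) and `RazYehudayoff2008_smCircuit_holds` (`f_n` has fan-in-two
  syntactically multilinear CIRCUITS with `≤ C(n³+1)` gates): **an explicit family of polynomial
  multilinear-circuit size lies OUTSIDE THE CLOSURE of polynomial-size syntactically multilinear
  formulas** — Raz's separation of multilinear formula from multilinear circuit size (multilinear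
  `NC¹ ≠ NC²`, Raz 2006 / Raz–Yehudayoff 2008) holds in the border setting, over every field.

Print status / placement (honest grade: known-in-print-as-remark, kernel-new, rung 0, 0 new currency,
`VP ≠ VNP` untouched).  «When we prove a lower bound against `𝒞_n` using test polynomials, we in fact prove
a lower bound against border-`𝒞_n`» [Grochow 2015, §3.2], and Raz's multilinear-formula bounds are
test-polynomial bounds — the separating module is the product over the finitely many restrictions /
partitions of the `(r+1) × (r+1)` minors of `M_f` [Grochow 2015, §5, row "multilinear formulas"]; the
`O(ε)` form of rank semicontinuity is Andrews–Forbes 2022, Lemma 6.2.  The border statement for `per_n`,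
`det_n` themselves (census W29's ladder field as worded) needs Raz 2009's random restrictions, which the
tree does not hold; that is an EXACT-world port, not a border issue, and is not claimed here.

References: [Raz2006] Prop. 2.1, Cor. 3.6; [RazYehudayoff2008] §4.1, Thm. 4.2, 4.4; [AndrewsForbes2022]
Def. 2.1, Lemma 6.2 (arXiv:2112.00792); [Grochow2015] §3.2, §5 (= CCC 2014, arXiv:1304.6333, pp. 8, 17).
-/

-- layout Summits/ValiantsHypothesis/ValiantsHypothesis forces the duplicated namespace component
set_option linter.dupNamespace false

namespace Summit.ValiantsHypothesis.ValiantsHypothesis.Theorems.VPBoundarySquare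

open MvPolynomial Literature.Computability.AlgebraicComplexity
open Literature.Computability.AlgebraicComplexity.WExpr
open Literature.Barriers.ValiantsHypothesis Literature.Barriers.ValiantsHypothesis.RazFormula

noncomputable section

universe u v w

/-! ### `O(ε)` bookkeeping and the mechanism: Raz's matrix is rank-lower-semicontinuous -/

/-- Renaming variables along an equivalence permutes coefficients: `O(ε^k)` stays `O(ε^k)`. [cite: AndrewsForbes2022, Def. 2.1] -/
theorem polyOrdGE_rename_equiv {F : Type u} [Field F] {σ : Type v} {τ : Type w} (A : σ ≃ τ)
    {k : ℤ} {p : MvPolynomial σ (LaurentSeries F)} (hp : PolyOrdGE k p) :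
    PolyOrdGE k (rename A p) := by
  intro d
  have hd : Finsupp.mapDomain A (Finsupp.mapDomain A.symm d) = d := by
    rw [← Finsupp.mapDomain_comp, Equiv.self_comp_symm, Finsupp.mapDomain_id]
  rw [← hd, coeff_rename_mapDomain _ A.injective]
  exact hp _

/-- **The mechanism: Raz's partial-derivative matrix is rank-lower-semicontinuous under `ε → 0`.**
If `h ∈ F((ε))[Y ⊔ Z]` approximates `g ∈ F[Y ⊔ Z]` (`h - g = O(ε)` coefficientwise), then
`rank_F M(g) ≤ rank_{F((ε))} M(h)`: the entries of `M(h)` are those of `M(g)` up to `O(ε)`, and linear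
independence of rows survives an `O(ε)` perturbation (Andrews–Forbes 2022, Lemma 6.2, the tree's
`BorderLST.finrank_span_le_of_isOrdGE`; `Matrix.rank` is the dimension of the row span).
[cite: AndrewsForbes2022, Lemma 6.2] [cite: RazYehudayoff2008, §4.2.2] -/
theorem pdMatrix_rank_le_of_polyOrdGE {F : Type u} [Field F] {m : ℕ}
    (g : MvPolynomial (Fin m ⊕ Fin m) F) (h : MvPolynomial (Fin m ⊕ Fin m) (LaurentSeries F))
    (hh : PolyOrdGE 1 (h - MvPolynomial.map (algebraMap F (LaurentSeries F)) g)) :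
    (pdMatrix g).rank ≤ (pdMatrix h).rank := by
  classical
  rw [Matrix.rank_eq_finrank_span_row, Matrix.rank_eq_finrank_span_row]
  refine BorderLST.finrank_span_le_of_isOrdGE (pdMatrix g).row (pdMatrix h).row fun S T => ?_
  show IsOrdGE 1 (coeff (setMonomial S T) h - algebraMap F (LaurentSeries F) (coeff (setMonomial S T) g))
  simpa only [coeff_sub, coeff_map] using hh (setMonomial S T)

/-! ### Raz 2006, Cor. 3.6 with a field-uniform threshold -/

/-- Polylog versus linear: `C · (a ⌊log₂ u⌋ + c)^k ≤ u` for all large `u`. [folklore] -/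
theorem exists_const_mul_pow_log_le (C a c k : ℕ) :
    ∃ u₀ : ℕ, ∀ u : ℕ, u₀ ≤ u → C * (a * Nat.log 2 u + c) ^ k ≤ u := by
  have ht := tendsto_pow_const_div_const_pow_of_one_lt k (show (1 : ℝ) < 2 by norm_num)
  set B : ℝ := (C : ℝ) * ((a : ℝ) + c) ^ k + 1 with hB
  have hBpos : 0 < B := by positivity
  have hev := ht.eventually (gt_mem_nhds (show (0 : ℝ) < 1 / B by positivity))
  obtain ⟨N, hN⟩ := Filter.eventually_atTop.1 hev
  refine ⟨2 ^ max N 1, fun u hu => ?_⟩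
  set l := Nat.log 2 u with hl
  have hu0 : u ≠ 0 := by have := Nat.one_le_two_pow (n := max N 1); omega
  have hlN : max N 1 ≤ l := Nat.le_log_of_pow_le one_lt_two hu
  have hl1 : 1 ≤ l := le_trans (le_max_right _ _) hlN
  have h2l : 2 ^ l ≤ u := Nat.pow_log_le_self 2 hu0
  have hlt := hN l (le_trans (le_max_left _ _) hlN)
  have h2pos : (0 : ℝ) < (2 : ℝ) ^ l := by positivity
  rw [div_lt_div_iff₀ h2pos hBpos, one_mul] at hlt
  have hmono : ((a : ℝ) * l + c) ^ k ≤ (((a : ℝ) + c) * l) ^ k := by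
    have : (c : ℝ) ≤ c * l := le_mul_of_one_le_right (by positivity) (by exact_mod_cast hl1)
    exact pow_le_pow_left₀ (by positivity) (by nlinarith) k
  have key : (C : ℝ) * ((a : ℝ) * l + c) ^ k ≤ (2 : ℝ) ^ l := by
    calc (C : ℝ) * ((a : ℝ) * l + c) ^ k ≤ C * ((((a : ℝ) + c) * l) ^ k) :=
          mul_le_mul_of_nonneg_left hmono (by positivity)
      _ = (C * ((a : ℝ) + c) ^ k) * (l : ℝ) ^ k := by rw [mul_pow]; ring
      _ ≤ B * (l : ℝ) ^ k := mul_le_mul_of_nonneg_right (by rw [hB]; linarith) (by positivity)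
      _ ≤ (2 : ℝ) ^ l := by rw [mul_comm]; exact hlt.le
  have key' : C * (a * l + c) ^ k ≤ 2 ^ l := by exact_mod_cast key
  exact key'.trans h2l

/-- **Raz 2006, Cor. 3.6 (polynomial form) with the threshold chosen before the field**: for every
`b` there is `n₀` such that over EVERY field `K`, for all `u ≥ n₀`, every syntactically multilinear
formula `Φ` with `|Φ| ≤ u^b` over `2u` variables computes a polynomial that is not of full rank.
The tree's `RazFormula.not_isFullRank_of_syntMultilinear_core` is called with `ℓ = 2(b+2)` levels,
`m = ⌊u/4^ℓ⌋`, `D = b(⌊log₂ u⌋ + 1) + 2`; its numeric side conditions hold for `u` beyond a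
field-free threshold. [cite: Raz2006, Cor. 3.6] -/
theorem not_isFullRank_of_syntMultilinear_uniform (b : ℕ) :
    ∃ n₀ : ℕ, ∀ (K : Type u) [Field K] (u : ℕ), n₀ ≤ u → ∀ e : WExpr K (Fin (2 * u)),
      IsSyntMultilinear e → e.size ≤ u ^ b → ¬ IsFullRank u e.eval := by
  set ℓ := 2 * (b + 2) with hℓ
  obtain ⟨u₁, hu₁⟩ := exists_const_mul_pow_log_le (4 ^ ℓ) (2 * b) (2 * b + 5) 1
  obtain ⟨u₂, hu₂⟩ := exists_const_mul_pow_log_le (4 ^ (ℓ * (b + 2) + 1)) (2 * b) (2 * b + 5) ℓ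
  refine ⟨max (max u₁ u₂) (4 ^ ℓ), fun K _ u hu e he hsize => ?_⟩
  have h4u : 4 ^ ℓ ≤ u := le_trans (le_max_right _ _) hu
  have h4pos : 0 < 4 ^ ℓ := by positivity
  have hu1 : 1 ≤ u := le_trans (Nat.one_le_pow _ _ (by norm_num)) h4u
  set L := Nat.log 2 u with hL
  have hlin : 4 ^ ℓ * (2 * b * L + (2 * b + 5)) ^ 1 ≤ u :=
    hu₁ u (le_trans (le_trans (le_max_left _ _) (le_max_left _ _)) hu)
  have hpoly : 4 ^ (ℓ * (b + 2) + 1) * (2 * b * L + (2 * b + 5)) ^ ℓ ≤ u :=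
    hu₂ u (le_trans (le_trans (le_max_right _ _) (le_max_left _ _)) hu)
  set D := b * (L + 1) + 2 with hD
  have hDeq : 2 * D + 1 = 2 * b * L + (2 * b + 5) := by rw [hD]; ring
  set m := u / 4 ^ ℓ with hm
  have hmu : m * 4 ^ ℓ ≤ u := Nat.div_mul_le_self u _
  have hm1 : 1 ≤ m := by rw [hm, Nat.le_div_iff_mul_le h4pos, one_mul]; exact h4u
  -- (iii) `|Φ| + 1 < 2^D`
  have hDlt : e.size + 1 < 2 ^ D := by
    have hlt : u < 2 ^ (L + 1) := Nat.lt_pow_succ_log_self one_lt_two u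
    have h0 : u ^ b ≤ 2 ^ (b * (L + 1)) :=
      calc u ^ b ≤ (2 ^ (L + 1)) ^ b := Nat.pow_le_pow_left hlt.le b
        _ = 2 ^ (b * (L + 1)) := by rw [← pow_mul, mul_comm]
    have h1 : 1 ≤ 2 ^ (b * (L + 1)) := Nat.one_le_two_pow
    have h2 : 2 ^ D = 2 ^ (b * (L + 1)) * 4 := by rw [hD, pow_add]; norm_num
    omega
  -- (iv) `2D + 1 ≤ m`
  have hmD : 2 * D + 1 ≤ m := by
    rw [hm, Nat.le_div_iff_mul_le h4pos, hDeq]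
    calc (2 * b * L + (2 * b + 5)) * 4 ^ ℓ = 4 ^ ℓ * (2 * b * L + (2 * b + 5)) ^ 1 := by
          rw [pow_one, mul_comm]
      _ ≤ u := hlin
  -- (v) the final inequality, in `ℝ`
  have hP : 4 ^ (ℓ * (b + 2) + 1) * (2 * D + 1) ^ ℓ ≤ u := by rw [hDeq]; exact hpoly
  have hfinal : ((e.size + 1 : ℕ) : ℝ) * (2 * u) * (2 * D + 1) ^ ℓ < ((m : ℝ) + 1) ^ (b + 2) := by
    have hsz : ((e.size + 1 : ℕ) : ℝ) ≤ 2 * (u : ℝ) ^ b := by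
      have : e.size + 1 ≤ 2 * u ^ b := by
        have : 1 ≤ u ^ b := Nat.one_le_pow _ _ hu1
        omega
      exact_mod_cast this
    have hPR : (4 : ℝ) ^ (ℓ * (b + 2) + 1) * (2 * D + 1 : ℝ) ^ ℓ ≤ u := by exact_mod_cast hP
    have hm' : (u : ℝ) < ((m : ℝ) + 1) * 4 ^ ℓ := by
      have := Nat.lt_mul_div_succ u h4pos
      have : (u : ℝ) < ((4 ^ ℓ * (u / 4 ^ ℓ + 1) : ℕ) : ℝ) := by exact_mod_cast this
      rw [hm]; push_cast at this ⊢; linarith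
    have h4R : (0 : ℝ) < (4 : ℝ) ^ ℓ := by positivity
    have hpow : ((u : ℝ) / 4 ^ ℓ) ^ (b + 2) < ((m : ℝ) + 1) ^ (b + 2) := by
      refine pow_lt_pow_left₀ ?_ (by positivity) (by omega)
      rw [div_lt_iff₀ h4R]; exact hm'
    -- `LHS ≤ 4 u^{b+1} (2D+1)^ℓ ≤ u^{b+2} / 4^{ℓ(b+2)} = (u/4^ℓ)^{b+2}`
    have hchain : ((e.size + 1 : ℕ) : ℝ) * (2 * u) * (2 * D + 1) ^ ℓ ≤
        ((u : ℝ) / 4 ^ ℓ) ^ (b + 2) := by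
      rw [div_pow, ← pow_mul, le_div_iff₀ (by positivity)]
      calc ((e.size + 1 : ℕ) : ℝ) * (2 * u) * (2 * D + 1) ^ ℓ * 4 ^ (ℓ * (b + 2))
          ≤ (2 * (u : ℝ) ^ b) * (2 * u) * (2 * D + 1) ^ ℓ * 4 ^ (ℓ * (b + 2)) := by gcongr
        _ = (u : ℝ) ^ (b + 1) * (4 ^ (ℓ * (b + 2) + 1) * (2 * D + 1 : ℝ) ^ ℓ) := by ring
        _ ≤ (u : ℝ) ^ (b + 1) * u := mul_le_mul_of_nonneg_left hPR (by positivity)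
        _ = (u : ℝ) ^ (b + 2) := by ring
    exact lt_of_le_of_lt hchain hpow
  exact not_isFullRank_of_syntMultilinear_core hm1 hmu he hDlt hmD hfinal

/-! ### ★ Border Raz: full-rank polynomials are not approximated by small multilinear formulas -/

/-- **BORDER RAZ, field-uniform form.**  For every `b` there is `n₀` such that over EVERY field `F`,
for all `u ≥ n₀`, no full-rank `g ∈ F[x_1,…,x_{2u}]` lies in the closure (Andrews–Forbes border class,
`h - g = O(ε)`) of the polynomials computed by syntactically multilinear formulas `Φ` over `F((ε))`
with `|Φ| ≤ u^b`: Raz's theorem over the field `F((ε))` makes some `rank M(Φ.eval^A) < 2^u`, while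
`2^u = rank_F M(g^A) ≤ rank_{F((ε))} M(Φ.eval^A)` (`pdMatrix_rank_le_of_polyOrdGE`).
[cite: Raz2006, Cor. 3.6] [cite: AndrewsForbes2022, Def. 2.1, Lemma 6.2] [cite: Grochow2015, §3.2] -/
theorem not_isFullRank_of_mem_borderClass_smlFormula_uniform (b : ℕ) :
    ∃ n₀ : ℕ, ∀ (F : Type u) [Field F] (u : ℕ), n₀ ≤ u → ∀ g : MvPolynomial (Fin (2 * u)) F,
      g ∈ borderClass F {h | ∃ e : WExpr (LaurentSeries F) (Fin (2 * u)),
              IsSyntMultilinear e ∧ e.size ≤ u ^ b ∧ e.eval = h} → ¬ IsFullRank u g := by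
  obtain ⟨n₀, hn₀⟩ := not_isFullRank_of_syntMultilinear_uniform.{u} b
  refine ⟨n₀, fun F _ u hu g hg hfull => ?_⟩
  obtain ⟨h, ⟨e, he, hsize, rfl⟩, happrox⟩ := hg
  refine hn₀ (LaurentSeries F) u hu e he hsize fun A => le_antisymm ?_ ?_
  · calc (pdMatrix (rename A e.eval)).rank ≤ Fintype.card (Finset (Fin u)) :=
          Matrix.rank_le_card_width _
      _ = 2 ^ u := by rw [Fintype.card_finset, Fintype.card_fin]
  · have hord : PolyOrdGE 1 (rename A e.eval -
        MvPolynomial.map (algebraMap F (LaurentSeries F)) (rename A g)) := by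
      rw [map_rename, ← map_sub]
      exact polyOrdGE_rename_equiv A happrox
    calc 2 ^ u = (pdMatrix (rename A g)).rank := (hfull A).symm
      _ ≤ (pdMatrix (rename A e.eval)).rank := pdMatrix_rank_le_of_polyOrdGE _ _ hord

/-- ★ **BORDER RAZ (Raz 2006, Cor. 3.6 in the border setting), one field at a time**: for every
field `F` and every `b` there is `n₀` such that for all `u ≥ n₀`, no full-rank
`g ∈ F[x_1,…,x_{2u}]` is even APPROXIMATED (`Φ.eval = g + O(ε)`) by a syntactically multilinear
formula `Φ` over `F((ε))` with `|Φ| ≤ u^b` — BORDER = EXACT for the full-rank method, with the same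
threshold. [cite: Raz2006, Cor. 3.6] [cite: AndrewsForbes2022, Def. 2.1, Lemma 6.2] [cite: Grochow2015, §3.2] -/
theorem not_isFullRank_of_mem_borderClass_smlFormula (F : Type u) [Field F] (b : ℕ) :
    ∃ n₀ : ℕ, ∀ u : ℕ, n₀ ≤ u → ∀ g : MvPolynomial (Fin (2 * u)) F,
      g ∈ borderClass F {h | ∃ e : WExpr (LaurentSeries F) (Fin (2 * u)),
              IsSyntMultilinear e ∧ e.size ≤ u ^ b ∧ e.eval = h} → ¬ IsFullRank u g := by
  obtain ⟨n₀, hn₀⟩ := not_isFullRank_of_mem_borderClass_smlFormula_uniform.{u} b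
  exact ⟨n₀, fun u hu g hg => hn₀ F u hu g hg⟩

/-- The same in the tree's circuit vocabulary: a fan-in-two syntactically multilinear FORMULA
(`IsFormula`, `IsFanInTwo`, `IsSyntacticallyMultilinear`) over `F((ε))` with `≤ u^b` gates that
computes `g + O(ε)` forces `g` not to be of full rank (`u ≥ n₀(b)`, every field; unfold the formula to
a tree, `ArithCircuit.toWExpr`). [cite: Raz2006, Prop. 2.1, Cor. 3.6] [cite: AndrewsForbes2022, Def. 2.1] -/
theorem not_isFullRank_of_border_syntMultilinear_formula (b : ℕ) :
    ∃ n₀ : ℕ, ∀ (F : Type u) [Field F] (u : ℕ), n₀ ≤ u →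
      ∀ (P : ArithCircuit (LaurentSeries F) (Fin (2 * u))) (h : MvPolynomial (Fin (2 * u)) (LaurentSeries F))
        (g : MvPolynomial (Fin (2 * u)) F),
        P.IsFormula → P.IsFanInTwo → Literature.Barriers.ValiantsHypothesis.IsSyntacticallyMultilinear P →
          P.Computes h → P.size ≤ u ^ b →
        PolyOrdGE 1 (h - MvPolynomial.map (algebraMap F (LaurentSeries F)) g) → ¬ IsFullRank u g := by
  obtain ⟨n₀, hn₀⟩ := not_isFullRank_of_mem_borderClass_smlFormula_uniform.{u} b
  refine ⟨n₀, fun F _ u hu P h g hf h2 hsm hPh hsize happrox => hn₀ F u hu g ?_⟩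
  have hev : P.toWExpr.eval = h := by rw [ArithCircuit.eval_toWExpr]; exact hPh
  exact ⟨h, ⟨P.toWExpr, isSyntMultilinear_toWExpr hsm, (ArithCircuit.size_toWExpr_le hf h2).trans hsize, hev⟩, happrox⟩

/-! ### ★ The Raz–Yehudayoff polynomial: multilinear NC¹ ≠ NC² in the border -/

/-- ★ **The Raz–Yehudayoff full-rank polynomial is outside the border of small multilinear formulas.**
For every field `F` and every `b` there is `n₀` such that for all `n ≥ n₀`, the Raz–Yehudayoff
polynomial `f_n ∈ G_n[x_1,…,x_{2n}]` (`G_n = F(W_n)`, the tree's `razYehudayoffPolyK F n`, of full rank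
by `RazYehudayoff2008_thm42_holds`) is NOT in the closure of the polynomials computed by syntactically
multilinear formulas over `G_n((ε))` of size `≤ n^b`. [cite: RazYehudayoff2008, Thm. 4.2, Thm. 4.4]
[cite: Raz2006, Cor. 3.6] [cite: Grochow2015, §3.2] -/
theorem razYehudayoffPolyK_not_mem_borderClass_smlFormula (F : Type u) [Field F] (b : ℕ) :
    ∃ n₀ : ℕ, ∀ n : ℕ, n₀ ≤ n →
      razYehudayoffPolyK F n ∉ borderClass (RYField F n)
        {h | ∃ e : WExpr (LaurentSeries (RYField F n)) (Fin (2 * n)),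
              IsSyntMultilinear e ∧ e.size ≤ n ^ b ∧ e.eval = h} := by
  obtain ⟨n₀, hn₀⟩ := not_isFullRank_of_mem_borderClass_smlFormula_uniform.{u} b
  exact ⟨n₀, fun n hn hmem => hn₀ (RYField F n) n hn _ hmem (RazYehudayoff2008_thm42_holds F n)⟩

/-- ★ **Multilinear `NC¹ ≠ NC²` holds in the border (Raz's separation of multilinear formula size
from multilinear circuit size, border version, every field).**  There is a constant `C` such that for
every `b` there is `n₀` with: for every field `F` and all `n ≥ n₀`, the Raz–Yehudayoff polynomial `f_n`
over `G_n = F(W_n)` HAS fan-in-two syntactically multilinear circuits with `≤ C(n³+1)` gates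
(`RazYehudayoff2008_smCircuit_holds`) and is NOT in the closure of the polynomials computed by
syntactically multilinear formulas over `G_n((ε))` of size `≤ n^b` — an explicit family of polynomial
multilinear-circuit size outside the CLOSURE of polynomial-size multilinear formulas.
[cite: Raz2006, Thm. 1.1, Cor. 3.6] [cite: RazYehudayoff2008, Thm. 4.2, Thm. 4.4] [cite: AlonKumarVolk2020, §4.1]
[cite: Grochow2015, §3.2] -/
theorem smCircuits_not_subset_border_smlFormulas :
    ∃ C : ℕ, ∀ b : ℕ, ∃ n₀ : ℕ, ∀ (F : Type u) [Field F] (n : ℕ), n₀ ≤ n →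
      Literature.Barriers.ValiantsHypothesis.smCircuitSize (razYehudayoffPolyK F n)
          ≤ ((C * (n ^ 3 + 1) : ℕ) : ℕ∞) ∧
      razYehudayoffPolyK F n ∉ borderClass (RYField F n)
        {h | ∃ e : WExpr (LaurentSeries (RYField F n)) (Fin (2 * n)),
              IsSyntMultilinear e ∧ e.size ≤ n ^ b ∧ e.eval = h} := by
  obtain ⟨C, hC⟩ := RazYehudayoff2008_smCircuit_holds.{u}
  refine ⟨C, fun b => ?_⟩
  obtain ⟨n₀, hn₀⟩ := not_isFullRank_of_mem_borderClass_smlFormula_uniform.{u} b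
  exact ⟨n₀, fun F _ n hn => ⟨hC F n, fun hmem =>
    hn₀ (RYField F n) n hn _ hmem (RazYehudayoff2008_thm42_holds F n)⟩⟩

end

end Summit.ValiantsHypothesis.ValiantsHypothesis.Theorems.VPBoundarySquare
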